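import Literature.NumberTheory.EllipticCurves.MasserWustholzSurjectivity
import Literature.NumberTheory.EllipticCurves.RationalIsogenyDegreesProofs
import Literature.NumberTheory.EllipticCurves.ShaRestriction
import Literature.NumberTheory.EllipticCurves.IsogenyHasCMBaseChangeProofs
import Literature.NumberTheory.EllipticCurves.GaloisActionProofs
import Literature.NumberTheory.DiophantineGeometry.StableFaltingsHeightMapProofs
import HarnessLib

/-!
# Masser–Wüstholz 1993, §4: "over `k₀` we are back in case (i)" — the fields of degree `≤ 60`

Topic `NumberTheory/EllipticCurves`; a proofs-only sibling (theorems only: no definitions, no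
named facts) of `MasserWustholzSurjectivity` (the named fact
`Literature.NumberTheory.EllipticCurves.masserWustholz_surjective_modEll`: D. W. Masser,
G. Wüstholz, *Galois properties of division fields of elliptic curves*, Bull. London Math. Soc.
**25** (1993) 247–254, Theorem (b) at `k = ℚ`), continuing `MasserWustholzSurjectivityProofs`
(§4: the Theorem over `ℚ` from hypotheses `h31`, `h32`) and `MasserWustholzIsogenyArgumentsProofs`
(§3: Lemma 3.1 modulo the isogeny estimate, and `h31` from it).

In §4 of the paper the cases (ii) (normaliser of a Cartan subgroup `C`) and (iii) (image of
order `≤ 60` in `PGL₂`) are eliminated by passing to the field `k₀` cut out by `K = C ∩ φ_ℓ(G)`,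
resp. `K = 𝔽_ℓˣ ∩ φ_ℓ(G)`, of degree `≤ 2`, resp. `≤ 60` over `k`: "So over `k₀` we are back in
case (i). Thus to eliminate this it suffices to replace `d` by `2d`" (p. 250) — i.e. Lemmas 3.1
and 3.2 are applied to `E` regarded over `k₀`.  In the tree's language hypothesis `h32` of
`MasserWustholz1993.masserWustholz_surjective_modEll_of_effective_lemmas` asks, for a non-CM
`E/ℚ` and `ℓ` beyond the threshold, that `ρ̄_{E,ℓ}(U)` be non-commutative for every
`U ≤ Γ_ℚ` of index `≤ 60` containing `Gal(ℚ̄/ℚ(E[ℓ]))`.  This file performs the passage to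
`k₀ = ℚ̄^U` and back, so that what is left are statements about elliptic curves over number
fields of degree `≤ 60` — exactly the printed Lemma 2.2 (`n = 1`) and Lemma 3.2:

* `MasserWustholz1993.exists_intermediateField_of_isOpen` (an open `U ≤ Γ_K`, `K` perfect, is
  `Gal(K̄/k₀)` for `k₀ = K̄^U`, `[k₀ : K] = [Γ_K : U]`: Mathlib's infinite Galois correspondence),
  `exists_algHom_algebraicClosure_extending` (a `k₀`-linear `K`-embedding `K̄ → k̄₀`),
  `galoisRepTorsion_baseChange_comm` (along `E(K̄) ≅ E_L(L̄)` — the tree's `pointsMapOfEmb`,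
  `localPointsEquivGeomPoints` — commuting elements of `ρ̄_E(r(Γ_L))` give commuting elements of
  `ρ̄_{E_L}(Γ_L)`).
* `MasserWustholz1993.effectiveLemma32_of_numberFields` — **`h32` over `ℚ` from its form over
  number fields of degree `≤ 60`** (non-commutativity of `φ_ℓ(Gal(k̄₀/k₀))` for non-CM `E₀/k₀`
  beyond `c max(1, h_F(E₀))^γ`), using `not_hasCM_baseChange_of_not_hasCM` and the invariance
  of the stable height `stableFaltingsHeight_map_holds`.
* `MasserWustholz1993.not_hasIrreducibleModPGaloisRep_of_forall_scalar`,
  `MasserWustholz1993.numberFields_nonComm_of_effective_lemmas` — over the fields `k₀`: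
  Lemma 3.1 (irreducible `E[ℓ]`) and Lemma 3.2 (commutative ⇒ scalar) give the
  non-commutativity ("in case (i) we may suppose `φ_ℓ(G)` is not contained in `𝔽_ℓˣ` by (4.1)
  and using once again Lemma 3.1", p. 250: scalars fix a line).

The final assembly — the named fact from (I) the isogeny estimate for elliptic curves (Lemma 2.2,
`n = 1`) and (II) Lemma 3.2, both over number fields of degree `≤ 60` — is
`MasserWustholzDischargeShapeProofs`.  No definition and no named fact is introduced (D-0026).

## References

* [MasserWustholzBLMS1993] D. W. Masser, G. Wüstholz, Bull. London Math. Soc. 25 (1993)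
  247–254: §2 Lemma 2.2, §3 Lemmas 3.1–3.2, §4 (pp. 248–251).
-/
noncomputable section

open scoped Classical

universe u

namespace Literature.NumberTheory.EllipticCurves.MasserWustholz1993

open _root_.WeierstrassCurve Field IntermediateField

/-! ### The field `k₀` of an open subgroup of `Γ_K` -/

section FixedField

variable (K : Type u) [Field K] [PerfectField K]

/-- **The field of an open subgroup.**  For an open subgroup `U ≤ Γ_K = Gal(K̄/K)` (`K` perfect,
so `K̄/K` is Galois) the fixed field `k₀ = K̄^U` is a finite extension of `K` inside `K̄` with
`[k₀ : K] = [Γ_K : U]`, and every `σ ∈ Γ_K` fixing `k₀` pointwise lies in `U` (an open subgroup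
is closed, and the Galois correspondence `Gal(K̄/K̄^U) = U` holds for closed subgroups: Mathlib's
`InfiniteGalois.fixingSubgroup_fixedField`, `IntermediateField.finrank_eq_fixingSubgroup_index`,
`InfiniteGalois.isOpen_iff_finite`). [folklore] -/
theorem exists_intermediateField_of_isOpen (U : Subgroup (absoluteGaloisGroup K))
    (hU : IsOpen (U : Set (absoluteGaloisGroup K))) :
    ∃ F : IntermediateField K (AlgebraicClosure K), FiniteDimensional K F ∧
      Module.finrank K F = U.index ∧
      ∀ σ : absoluteGaloisGroup K, (∀ x ∈ F, σ • x = x) → σ ∈ U := by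
  haveI : IsGalois K (AlgebraicClosure K) := {}
  let Uc : ClosedSubgroup (AlgebraicClosure K ≃ₐ[K] AlgebraicClosure K) :=
    ⟨U, U.isClosed_of_isOpen hU⟩
  have hfix : (fixedField (Uc : Subgroup (AlgebraicClosure K ≃ₐ[K] AlgebraicClosure K))).fixingSubgroup
      = U := InfiniteGalois.fixingSubgroup_fixedField Uc
  refine ⟨fixedField (Uc : Subgroup (AlgebraicClosure K ≃ₐ[K] AlgebraicClosure K)),
    by rw [← InfiniteGalois.isOpen_iff_finite, hfix]; exact hU,
    by rw [IntermediateField.finrank_eq_fixingSubgroup_index, hfix]; rfl, fun σ hσ ↦ ?_⟩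
  have hmem : absoluteGaloisGroup.toAlgEquiv K σ ∈ (fixedField
      (Uc : Subgroup (AlgebraicClosure K ≃ₐ[K] AlgebraicClosure K))).fixingSubgroup :=
    (IntermediateField.mem_fixingSubgroup_iff _ _).mpr hσ
  rw [hfix] at hmem
  exact hmem

omit [PerfectField K] in
/-- **An embedding `K̄ → k̄₀` over `k₀`.**  For an intermediate field `k₀` of `K̄/K` there is a
`K`-embedding `ι : K̄ → \overline{k₀}` of algebraic closures which is `k₀`-linear, i.e. restricts
on `k₀ ⊂ K̄` to the structure map `k₀ → \overline{k₀}` (`IsAlgClosed.lift` over `k₀`).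
[folklore] -/
theorem exists_algHom_algebraicClosure_extending (F : IntermediateField K (AlgebraicClosure K)) :
    ∃ ι : AlgebraicClosure K →ₐ[K] AlgebraicClosure F,
      ∀ x : F, ι (x : AlgebraicClosure K) = algebraMap F (AlgebraicClosure F) x := by
  haveI : Algebra.IsAlgebraic F (AlgebraicClosure K) :=
    Algebra.IsAlgebraic.tower_top (K := K) (L := F) (A := AlgebraicClosure K)
  haveI : Module.IsTorsionFree F (AlgebraicClosure F) := DivisionSemiring.to_moduleIsTorsionFree
  haveI : Module.IsTorsionFree F (AlgebraicClosure K) := DivisionSemiring.to_moduleIsTorsionFree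
  let ι₀ : AlgebraicClosure K →ₐ[F] AlgebraicClosure F := IsAlgClosed.lift
  refine ⟨ι₀.restrictScalars K, fun x ↦ ?_⟩
  rw [AlgHom.restrictScalars_apply]
  exact ι₀.commutes x

end FixedField

/-! ### Transport of `ρ̄_{E,n}` along `E(K̄) ≅ E_L(L̄)` -/

section Transport

variable {K : Type u} [Field K] (W : WeierstrassCurve K) (L : Type u) [Field L] [Algebra K L]
  [Algebra.IsAlgebraic K L] (ι : AlgebraicClosure K →ₐ[K] AlgebraicClosure L)

/-- **`φ_ℓ(G₀)` computed on `E` or on `E_{k₀}`.**  Let `L/K` be algebraic, `ι : K̄ → L̄` a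
`K`-embedding and `r = r_ι : Γ_L → Γ_K` the restriction along `ι` (the tree's `resGalOfEmb`).
Along the `Γ_L`-equivariant isomorphism `E(K̄) ≅ E_L(L̄)` (`pointsMapOfEmb`, bijective for `L/K`
algebraic, followed by `localPointsEquivGeomPoints`) the action of `γ ∈ Γ_L` on `E_L[n]` is the
action of `r γ` on `E[n]`; in particular if `ρ̄_{E,n}(r γ₁)` and `ρ̄_{E,n}(r γ₂)` commute then so
do `ρ̄_{E_L,n}(γ₁)` and `ρ̄_{E_L,n}(γ₂)` ("`φ_ℓ(G₀)`", §4 case (ii): the image of `G₀ = Gal(k̄/k₀)`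
is the same whether `E` is regarded over `k` or over `k₀`). [folklore] -/
theorem galoisRepTorsion_baseChange_comm (n : ℤ) {γ₁ γ₂ : absoluteGaloisGroup L}
    (h : galoisRepTorsion W n (resGalOfEmb ι γ₁) * galoisRepTorsion W n (resGalOfEmb ι γ₂) =
      galoisRepTorsion W n (resGalOfEmb ι γ₂) * galoisRepTorsion W n (resGalOfEmb ι γ₁)) :
    galoisRepTorsion (W.baseChange L) n γ₁ * galoisRepTorsion (W.baseChange L) n γ₂ =
      galoisRepTorsion (W.baseChange L) n γ₂ * galoisRepTorsion (W.baseChange L) n γ₁ := by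
  -- the transport map `T : E(K̄) → E_L(L̄)`
  set T : geomPoints W →+ geomPoints (W.baseChange L) :=
    (localPointsEquivGeomPoints W L).toAddMonoidHom.comp (pointsMapOfEmb W ι) with hT
  have hTsmul : ∀ (γ : absoluteGaloisGroup L) (P : geomPoints W),
      T (resGalOfEmb ι γ • P) = γ • T P := fun γ P ↦ by
    change localPointsEquivGeomPoints W L (pointsMapOfEmb W ι _) =
      γ • localPointsEquivGeomPoints W L (pointsMapOfEmb W ι P)
    rw [pointsMapOfEmb_smul, localPointsEquivGeomPoints_smul]
  have hTbij : Function.Bijective T :=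
    (localPointsEquivGeomPoints W L).bijective.comp (pointsMapOfEmb_bijective L W ι)
  -- pointwise form of `h` on `E[n]`
  have hpt : ∀ P : geomPoints W, P ∈ geomTorsion W n →
      resGalOfEmb ι γ₁ • resGalOfEmb ι γ₂ • P = resGalOfEmb ι γ₂ • resGalOfEmb ι γ₁ • P := by
    intro P hP
    have := congrArg (fun f : Multiplicative (AddAut (geomTorsion W n)) ↦
      ((Multiplicative.toAdd f ⟨P, hP⟩ : geomTorsion W n) : geomPoints W)) h
    simpa only [toAdd_mul, AddAut.add_apply, galoisRepTorsion_apply,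
      AddSubgroup.torsionBy.coe_smul] using this
  -- conclude pointwise on `E_L[n]`
  apply Multiplicative.toAdd.injective
  ext Q
  change ((γ₁ • γ₂ • Q : geomTorsion (W.baseChange L) n) : geomPoints (W.baseChange L)) =
    ((γ₂ • γ₁ • Q : geomTorsion (W.baseChange L) n) : geomPoints (W.baseChange L))
  simp only [AddSubgroup.torsionBy.coe_smul]
  obtain ⟨P, hP⟩ := hTbij.2 (Q : geomPoints (W.baseChange L))
  have hPn : P ∈ geomTorsion W n := by
    rw [mem_torsionBy_iff]
    apply hTbij.1
    rw [map_zsmul, map_zero, hP]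
    exact mem_torsionBy_iff.mp Q.2
  rw [← hP]
  calc γ₁ • γ₂ • T P = T (resGalOfEmb ι γ₁ • resGalOfEmb ι γ₂ • P) := by rw [hTsmul, hTsmul]
    _ = T (resGalOfEmb ι γ₂ • resGalOfEmb ι γ₁ • P) := by rw [hpt P hPn]
    _ = γ₂ • γ₁ • T P := by rw [hTsmul, hTsmul]

end Transport

/-! ### Over `ℚ`: hypothesis `h32` of the §4 assembly from its form over number fields -/

section Rat

/-- **"So over `k₀` we are back in case (i)" (§4, cases (ii)–(iii)).**  Hypothesis `h32` of
`MasserWustholz1993.masserWustholz_surjective_modEll_of_effective_lemmas` — for a non-CM `E/ℚ`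
and a prime `ℓ > c · max(1, h_F(E))^γ`, `ρ̄_{E,ℓ}(U)` is not commutative for every `U ≤ Γ_ℚ` of
index `≤ 60` containing `Gal(ℚ̄/ℚ(E[ℓ]))` — follows from the corresponding statement for
elliptic curves over number fields of degree `≤ 60`: absolute `c, γ` such that for every number
field `k₀` with `[k₀ : ℚ] ≤ 60`, every non-CM `E₀/k₀` and every prime
`ℓ > c · max(1, h_F(E₀))^γ` the image `φ_ℓ(Gal(k̄₀/k₀))` is not commutative (in the paper:
Lemma 3.2 over `k₀` makes a commutative image scalar, and Lemma 3.1 over `k₀` excludes scalars,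
with `M = max{d₀, h} ≤ 60 max{1, h}`).  Proof: `U ⊇ ker ρ̄_{E,ℓ}` is open
(`isOpen_ker_galoisRepTorsion_holds`), hence closed; `k₀ = ℚ̄^U` is a number field with
`[k₀ : ℚ] = [Γ_ℚ : U] ≤ 60` (`exists_intermediateField_of_isOpen`); `E₀ = E ⊗ k₀` has no CM
(`not_hasCM_baseChange_of_not_hasCM`) and the same stable height
(`stableFaltingsHeight_map_holds`); along a `k₀`-linear `ι : ℚ̄ → k̄₀`
(`exists_algHom_algebraicClosure_extending`) the restriction `Γ_{k₀} → Γ_ℚ` lands in `U`, and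
the images correspond (`galoisRepTorsion_baseChange_comm`).
[cite: MasserWustholzBLMS1993, §4 (proof of part (a), cases (ii)–(iii), pp. 250–251)] -/
theorem effectiveLemma32_of_numberFields
    (hNF : ∃ (c γ : ℝ), 0 ≤ γ ∧ ∀ (k : Type) [Field k] [NumberField k],
      Module.finrank ℚ k ≤ 60 → ∀ (V : WeierstrassCurve k) [V.IsElliptic], ¬ V.HasCM →
        ∀ ℓ : ℕ, ℓ.Prime → c * (max 1 V.stableFaltingsHeight) ^ γ < ℓ →
          ∃ γ₁ γ₂ : absoluteGaloisGroup k,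
            galoisRepTorsion V ℓ γ₁ * galoisRepTorsion V ℓ γ₂ ≠
              galoisRepTorsion V ℓ γ₂ * galoisRepTorsion V ℓ γ₁) :
    ∃ (c γ : ℝ), 0 ≤ γ ∧ ∀ (W : WeierstrassCurve ℚ) [W.IsElliptic], ¬ W.HasCM →
      ∀ ℓ : ℕ, ℓ.Prime → c * (max 1 W.stableFaltingsHeight) ^ γ < ℓ →
        ∀ U : Subgroup (absoluteGaloisGroup ℚ), (galoisRepTorsion W ℓ).ker ≤ U →
          U.index ≤ 60 → ∃ σ ∈ U, ∃ τ ∈ U,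
            galoisRepTorsion W ℓ σ * galoisRepTorsion W ℓ τ ≠
              galoisRepTorsion W ℓ τ * galoisRepTorsion W ℓ σ := by
  obtain ⟨c, γ, hγ, h⟩ := hNF
  refine ⟨c, γ, hγ, fun W _ hW ℓ hℓ hlt U hker hidx ↦ ?_⟩
  -- `U` is open
  have hUo : IsOpen (U : Set (absoluteGaloisGroup ℚ)) :=
    Subgroup.isOpen_mono hker
      (isOpen_ker_galoisRepTorsion_holds W (n := (ℓ : ℤ)) (by exact_mod_cast hℓ.ne_zero))
  -- the fixed field `k₀ = ℚ̄^U`, a number field of degree `[Γ_ℚ : U] ≤ 60`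
  obtain ⟨F, hFfin, hFrank, hFU⟩ := exists_intermediateField_of_isOpen ℚ U hUo
  haveI := hFfin
  haveI : NumberField F := NumberField.of_module_finite ℚ F
  have hdeg : Module.finrank ℚ F ≤ 60 := by rw [hFrank]; exact hidx
  -- `E₀ = E ⊗ k₀`
  have hVcm : ¬ (W.baseChange F).HasCM := not_hasCM_baseChange_of_not_hasCM (L := F) hW
  have hVh : (W.baseChange F).stableFaltingsHeight = W.stableFaltingsHeight :=
    stableFaltingsHeight_map_holds (K := ℚ) (L := F) W
  obtain ⟨γ₁, γ₂, hne⟩ := h F hdeg (W.baseChange F) hVcm ℓ hℓ (by rw [hVh]; exact hlt)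
  -- a `k₀`-linear embedding `ι : ℚ̄ → k̄₀`; the restriction along it lands in `U`
  obtain ⟨ι, hι⟩ := exists_algHom_algebraicClosure_extending ℚ F
  have hrU : ∀ g : absoluteGaloisGroup F, resGalOfEmb ι g ∈ U := by
    intro g
    refine hFU (resGalOfEmb ι g) fun x hx ↦ ι.injective ?_
    refine (apply_resGalAuxOfEmb_apply ι g x).trans ?_
    have hx' : ι x = algebraMap F (AlgebraicClosure F) ⟨x, hx⟩ := hι ⟨x, hx⟩
    rw [hx']
    exact (AlgEquiv.commutes (absoluteGaloisGroup.toAlgEquiv F g) ⟨x, hx⟩).trans hx'.symm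
  refine ⟨resGalOfEmb ι γ₁, hrU γ₁, resGalOfEmb ι γ₂, hrU γ₂, fun heq ↦ hne ?_⟩
  exact galoisRepTorsion_baseChange_comm W F ι ℓ heq

end Rat

/-! ### Over number fields of degree `≤ 60`: `hNF` from Lemmas 3.1 and 3.2 there -/

section NumberFields

/-- **A scalar `φ_ℓ(G)` fixes a line** (§4, case (i): "we may suppose `φ_ℓ(G)` is not contained
in `𝔽_ℓˣ` by (4.1) and using once again Lemma 3.1"): if every `γ ∈ Γ_k` acts on `E[ℓ]` as an
integer scalar (`ℓ` a prime invertible in `k`), then the line through any non-zero point of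
`E[ℓ]` (there is one: `#E[ℓ] = ℓ²`) is `Γ_k`-stable of order `ℓ`, so `E[ℓ]` is reducible.
[cite: MasserWustholzBLMS1993, §4 (proof of part (a), case (i), p. 250)] -/
theorem not_hasIrreducibleModPGaloisRep_of_forall_scalar {k : Type u} [Field k]
    (V : WeierstrassCurve k) [V.IsElliptic] {ℓ : ℕ} (hℓ : ℓ.Prime) (hℓk : (ℓ : k) ≠ 0)
    (hsc : ∀ γ : absoluteGaloisGroup k, ∃ a : ℤ, ∀ P : V.geomPoints,
      P ∈ geomTorsion V ℓ → γ • P = a • P) :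
    ¬ V.HasIrreducibleModPGaloisRep ℓ := by
  haveI : Fact ℓ.Prime := ⟨hℓ⟩
  haveI : NeZero (ℓ : k) := ⟨hℓk⟩
  rw [Mazur1978.not_hasIrreducibleModPGaloisRep_iff_exists_natCard_eq]
  -- a non-zero point `P ∈ E[ℓ]` (`#E[ℓ] = ℓ²`)
  have hcard : Nat.card (geomTorsion V (ℓ : ℤ)) = ℓ ^ 2 := natCard_geomTorsion_eq_sq V hℓk
  haveI := Nat.finite_of_card_ne_zero (by rw [hcard]; exact pow_ne_zero 2 hℓ.ne_zero)
  haveI : Nontrivial (geomTorsion V (ℓ : ℤ)) := by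
    rw [← Finite.one_lt_card_iff_nontrivial, hcard]; exact Nat.one_lt_pow two_ne_zero hℓ.one_lt
  obtain ⟨P, hP0⟩ := exists_ne (0 : geomTorsion V (ℓ : ℤ))
  -- the line `ℤ P` is stable and has `ℓ` elements
  refine ⟨AddSubgroup.zmultiples P, fun σ Q hQ ↦ ?_, ?_⟩
  · obtain ⟨m, rfl⟩ := AddSubgroup.mem_zmultiples_iff.mp hQ
    obtain ⟨a, ha⟩ := hsc σ
    have hσP : σ • P = a • P := Subtype.ext (by
      rw [AddSubgroup.torsionBy.coe_smul, AddSubgroupClass.coe_zsmul]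
      exact ha P P.2)
    have hcomm : σ • m • P = m • σ • P :=
      map_zsmul (DistribSMul.toAddMonoidHom (geomTorsion V (ℓ : ℤ)) σ) m P
    rw [hcomm, hσP, smul_smul]
    exact AddSubgroup.mem_zmultiples_iff.mpr ⟨m * a, rfl⟩
  · rw [Nat.card_zmultiples, addOrderOf_eq_of_ne_zero V ℓ hP0]

/-- **Lemmas 3.1 and 3.2 over `k₀` give a non-commutative `φ_ℓ(G₀)`.**  From the effective
Lemma 3.1 over number fields of degree `≤ 60` (`E[ℓ]` irreducible beyond `c₁ max(1, h)^{γ₁}`) and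
the effective Lemma 3.2 there (a commutative `φ_ℓ(G)` consists of scalars beyond
`c₂ max(1, h)^{γ₂}`): beyond `max(c₁, c₂, 0) · max(1, h)^{max(γ₁, γ₂)}` the image
`φ_ℓ(Gal(k̄/k))` is not commutative — otherwise it is scalar and fixes a line
(`not_hasIrreducibleModPGaloisRep_of_forall_scalar`).  This is hypothesis `hNF` of
`effectiveLemma32_of_numberFields`. [cite: MasserWustholzBLMS1993, §4 (proof of part (a), cases (i)–(iii), pp. 250–251)] -/
theorem numberFields_nonComm_of_effective_lemmas
    (h31k : ∃ (c γ : ℝ), 0 ≤ γ ∧ ∀ (k : Type) [Field k] [NumberField k],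
      Module.finrank ℚ k ≤ 60 → ∀ (V : WeierstrassCurve k) [V.IsElliptic], ¬ V.HasCM →
        ∀ ℓ : ℕ, ℓ.Prime → c * (max 1 V.stableFaltingsHeight) ^ γ < ℓ →
          V.HasIrreducibleModPGaloisRep ℓ)
    (h32k : ∃ (c γ : ℝ), 0 ≤ γ ∧ ∀ (k : Type) [Field k] [NumberField k],
      Module.finrank ℚ k ≤ 60 → ∀ (V : WeierstrassCurve k) [V.IsElliptic], ¬ V.HasCM →
        ∀ ℓ : ℕ, ℓ.Prime → c * (max 1 V.stableFaltingsHeight) ^ γ < ℓ →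
          (∀ γ₁ γ₂ : absoluteGaloisGroup k,
            galoisRepTorsion V ℓ γ₁ * galoisRepTorsion V ℓ γ₂ =
              galoisRepTorsion V ℓ γ₂ * galoisRepTorsion V ℓ γ₁) →
          ∀ γ : absoluteGaloisGroup k, ∃ a : ℤ, ∀ P : V.geomPoints,
            P ∈ geomTorsion V ℓ → γ • P = a • P) :
    ∃ (c γ : ℝ), 0 ≤ γ ∧ ∀ (k : Type) [Field k] [NumberField k],
      Module.finrank ℚ k ≤ 60 → ∀ (V : WeierstrassCurve k) [V.IsElliptic], ¬ V.HasCM →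
        ∀ ℓ : ℕ, ℓ.Prime → c * (max 1 V.stableFaltingsHeight) ^ γ < ℓ →
          ∃ γ₁ γ₂ : absoluteGaloisGroup k,
            galoisRepTorsion V ℓ γ₁ * galoisRepTorsion V ℓ γ₂ ≠
              galoisRepTorsion V ℓ γ₂ * galoisRepTorsion V ℓ γ₁ := by
  obtain ⟨c₁, γ₁, hγ₁, h₁⟩ := h31k
  obtain ⟨c₂, γ₂, hγ₂, h₂⟩ := h32k
  refine ⟨max (max c₁ c₂) 0, max γ₁ γ₂, le_max_of_le_left hγ₁, ?_⟩
  intro k _ _ hk V _ hV ℓ hℓ hlt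
  set B : ℝ := max 1 V.stableFaltingsHeight
  set c : ℝ := max (max c₁ c₂) 0
  set γ : ℝ := max γ₁ γ₂
  have hB1 : 1 ≤ B := le_max_left _ _
  have hB0 : 0 ≤ B := zero_le_one.trans hB1
  -- both thresholds lie below `c * B ^ γ`
  have hthr : ∀ {c' γ' : ℝ}, c' ≤ c → 0 ≤ γ' → γ' ≤ γ → c' * B ^ γ' < ℓ := by
    intro c' γ' hc' _ hγ'
    have h0 : 0 ≤ B ^ γ' := Real.rpow_nonneg hB0 γ'
    have hmono : B ^ γ' ≤ B ^ γ := Real.rpow_le_rpow_of_exponent_le hB1 hγ'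
    calc c' * B ^ γ' ≤ max c' 0 * B ^ γ' := mul_le_mul_of_nonneg_right (le_max_left _ _) h0
      _ ≤ max c' 0 * B ^ γ := mul_le_mul_of_nonneg_left hmono (le_max_right _ _)
      _ ≤ c * B ^ γ := mul_le_mul_of_nonneg_right (max_le hc' (le_max_right _ _)) (h0.trans hmono)
      _ < ℓ := hlt
  by_contra hall
  push Not at hall
  exact not_hasIrreducibleModPGaloisRep_of_forall_scalar V hℓ (Nat.cast_ne_zero.mpr hℓ.ne_zero)
    (h₂ k hk V hV ℓ hℓ (hthr ((le_max_right _ _).trans (le_max_left _ _)) hγ₂ (le_max_right _ _))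
      hall)
    (h₁ k hk V hV ℓ hℓ (hthr ((le_max_left _ _).trans (le_max_left _ _)) hγ₁ (le_max_left _ _)))

end NumberFields

end Literature.NumberTheory.EllipticCurves.MasserWustholz1993

end
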